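import Mathlib
import Literature.NumberTheory.Transcendental.PeriodsWave0
import HarnessLib

/-!
# Brown–Zudilin: cellular rational approximations to `ζ(5)` — data, worthiness, Theorem 1

Topic `Literature/NumberTheory/Irrationality/BrownZudilin2022`. Typed, cited statements from
F. Brown, W. Zudilin, *On cellular rational approximations to `ζ(5)`*, arXiv:2210.03391 (v3,
29 Jan 2026) [BrownZudilin2022] — the record *effective* rational approximations to `ζ(5)`
(`|ζ(5) − p/q| < q^{−0.86}`), obtained from the 8-parameter family of cellular integrals `₈π₈^∨` on the
moduli space `M_{0,8}` [Brown2016, Example 7.5]. HONEST FRAMING (cell pub-zeta5): systematic search; no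
irrationality claim unless certified. Nothing here asserts anything about the arithmetic nature of `ζ(5)`:
Theorem 1 is vendored as a NAMED FACT (statement only) and, as its authors stress, "does not imply
the (expected!) irrationality of `ζ(5)`" [BrownZudilin2022, §1].

## Contents

* DATA (computable): the parameter vector `a = (a₁,…,a₈) ∈ ℤ⁸` as `Fin 8 → ℤ`, the derived exponents
  `b₂₄, b₁₄, b₅₇, b₃₅, b₃₆` of (2), the seventeen linear forms (3) (`convergenceForms`) and the predicate
  `Converges a` ("all seventeen are non-negative" — by [Brown2016, §§5.1–5.2] exactly the convergence
  condition of the integral (1)); PROVED: the totally symmetric vectors `(n,…,n)` and the two printed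
  vectors `(8,16,10,15,12,16,18,13)` (§11) and `(15,20,16,14,18,17,16,20)` (§12) converge.
* The integral (1) as a real DEFINITION `cellularIntegral a` (Bochner integral over the open simplex
  `0 < t₁ < ⋯ < t₅ < 1`; for non-convergent `a` this is Mathlib's junk value, documented).
* WORTHINESS [BrownZudilin2022, §2 p. 6]: `worthiness c₀ c₁ = (c₁ − c₀)/c₁` and the two PROVED lemmas
  the source states in words — `abs_sub_div_lt_of_rates` ("for any choice of `ε > 0` and all `n`
  sufficiently large, `|ζ(5) − pₙ/qₙ| < qₙ^{−(γ−ε)}`", for any real `ξ` in place of `ζ(5)`) and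
  `irrational_of_smallForms` ("When `γ > 1`, the inequalities imply that `ζ(5)` is irrational": integer
  forms `qₙξ − pₙ → 0`, nonzero infinitely often, force `ξ ∉ ℚ`). These are the cell's MARGIN
  bookkeeping (margin = `γ − 1`).
* `IsAperyType p q` — "effective": `pₙ, qₙ ∈ ℚ` solve one linear difference equation with coefficients
  in `ℚ[n]` [BrownZudilin2022, §1 (after Nesterenko 2016)]; and the NAMED FACT `theorem1` — Theorem 1.
  CORRECTION (2026-08-20): `theorem1` as first typed is VACUOUS (`theorem1_vacuous` proves it from `1 < ζ(5) < 2`);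
  the faithful rendering is `theorem1'` (one Apéry-type pair `pₙ/qₙ → ζ(5)`, printed inequality with the reduced
  denominator), still a NAMED FACT (statement only).

## Deliberately NOT here
The decomposition (4) `I = Q(2ζ(5)+4ζ(3)ζ(2)) − 4P̂ζ(2) − 2P` for general `a`, the group `G ≅ S₇`
(§§8–10), the denominators `D(a)` (§7) and the asymptotics (§6): these are the objects the cell
reproduces with two implementations; only the end result (Theorem 1) is vendored. The totally symmetric
case is Zudilin's 2002 recursion, typed in `Irrationality/Zudilin2002/ZetaFiveRecursion.lean`
(`Qₙ = (−1)ⁿ⁺¹ qₙ / C(2n,n)`, [BrownZudilin2022, §2]).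
-/

noncomputable section

open Filter MeasureTheory
open scoped Topology

namespace Literature.NumberTheory.Irrationality.BrownZudilin2022

open Literature.NumberTheory.Transcendental (zetaValue)

/-! ### The parameters and the seventeen convergence conditions -/

/-- `b₂₄ = a₂ + a₃ + a₆ − a₇ − a₈` (indices of `a` are `0,…,7` for `a₁,…,a₈`). [cite: BrownZudilin2022, §1 eq. (2)] -/
def b24 (a : Fin 8 → ℤ) : ℤ := a 1 + a 2 + a 5 - a 6 - a 7
/-- `b₁₄ = a₄ + a₇ + a₈ − a₂ − a₆`. [cite: BrownZudilin2022, §1 eq. (2)] -/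
def b14 (a : Fin 8 → ℤ) : ℤ := a 3 + a 6 + a 7 - a 1 - a 5
/-- `b₅₇ = a₄ + a₅ + a₈ − a₂ − a₃`. [cite: BrownZudilin2022, §1 eq. (2)] -/
def b57 (a : Fin 8 → ℤ) : ℤ := a 3 + a 4 + a 7 - a 1 - a 2
/-- `b₃₅ = a₂ + a₃ − a₈`. [cite: BrownZudilin2022, §1 eq. (2)] -/
def b35 (a : Fin 8 → ℤ) : ℤ := a 1 + a 2 - a 7
/-- `b₃₆ = a₈`. [cite: BrownZudilin2022, §1 eq. (2)] -/
def b36 (a : Fin 8 → ℤ) : ℤ := a 7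

/-- The seventeen linear forms of (3), in the printed order:
`a₁, a₂, a₃, a₄, a₅, a₆, a₇, a₁+a₅−a₃, a₃+a₆−a₈, a₄+a₅+a₇+a₈−a₂−a₃−a₆, a₇+a₈−a₆, a₄+a₈−a₂,
a₂+a₃+a₆−a₄−a₈, a₁+a₈−a₃, a₁+a₂−a₄, a₄+a₅−a₂, a₄+a₇+2a₈−a₂−a₃−a₆`.
[cite: BrownZudilin2022, §1 eq. (3)] -/
def convergenceForms (a : Fin 8 → ℤ) : List ℤ :=
  [a 0, a 1, a 2, a 3, a 4, a 5, a 6, a 0 + a 4 - a 2, a 2 + a 5 - a 7,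
    a 3 + a 4 + a 6 + a 7 - a 1 - a 2 - a 5, a 6 + a 7 - a 5, a 3 + a 7 - a 1,
    a 1 + a 2 + a 5 - a 3 - a 7, a 0 + a 7 - a 2, a 0 + a 1 - a 3, a 3 + a 4 - a 1,
    a 3 + a 6 + 2 * a 7 - a 1 - a 2 - a 5]

/-- "the integral `I(a)` converges if and only if the following seventeen linear forms in the `aᵢ` are
non-negative" (for integer parameters). [cite: BrownZudilin2022, §1 eq. (3) (from Brown2016 §§5.1–5.2)] -/
def Converges (a : Fin 8 → ℤ) : Prop :=
  ∀ x ∈ convergenceForms a, 0 ≤ x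

/-- `Converges a` is decidable. [folklore] -/
instance instDecidableConverges (a : Fin 8 → ℤ) : Decidable (Converges a) := by
  unfold Converges; infer_instance

/-- The totally symmetric parameters `a₁ = ⋯ = a₈ = n ≥ 0` converge (§2). [cite: BrownZudilin2022, §2] -/
theorem converges_symmetric (n : ℕ) : Converges fun _ => (n : ℤ) := by
  intro x hx
  simp only [convergenceForms, List.mem_cons, List.not_mem_nil, or_false] at hx
  rcases hx with h | h | h | h | h | h | h | h | h | h | h | h | h | h | h | h | h <;> subst h <;> omega

/-- The vector `a = (8,16,10,15,12,16,18,13)` of the proof of Theorem 1 converges.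
[cite: BrownZudilin2022, §11] -/
theorem converges_thm1_vector : Converges ![8, 16, 10, 15, 12, 16, 18, 13] := by decide

/-- The vector `a = (15,20,16,14,18,17,16,20)` of §12 converges. [cite: BrownZudilin2022, §12] -/
theorem converges_sect12_vector : Converges ![15, 20, 16, 14, 18, 17, 16, 20] := by decide

/-! ### The integral (1) -/

/-- The open simplex `0 < t₁ < t₂ < t₃ < t₄ < t₅ < 1` in `ℝ⁵` (`t : Fin 5 → ℝ`). [cite: BrownZudilin2022, §1 eq. (1)] -/
def openSimplex : Set (Fin 5 → ℝ) :=
  {t | 0 < t 0 ∧ t 0 < t 1 ∧ t 1 < t 2 ∧ t 2 < t 3 ∧ t 3 < t 4 ∧ t 4 < 1}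

/-- The integrand of (1):
`t₁^{a₁}(t₂−t₁)^{a₂}(t₃−t₂)^{a₃}(t₄−t₃)^{a₄}(t₅−t₄)^{a₅}(1−t₅)^{a₆}` divided by
`(t₃−t₁)^{b₂₄} t₃^{b₁₄} (1−t₄)^{b₅₇} (t₄−t₂)^{b₃₅} (t₅−t₂)^{b₃₆}` and by the form factor
`(t₃−t₁) t₃ (1−t₄)(t₄−t₂)(t₅−t₂)` (integer powers `zpow`). [cite: BrownZudilin2022, §1 eq. (1)] -/
def integrand (a : Fin 8 → ℤ) (t : Fin 5 → ℝ) : ℝ :=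
  (t 0) ^ (a 0) * (t 1 - t 0) ^ (a 1) * (t 2 - t 1) ^ (a 2) * (t 3 - t 2) ^ (a 3) *
      (t 4 - t 3) ^ (a 4) * (1 - t 4) ^ (a 5) /
    ((t 2 - t 0) ^ (b24 a) * (t 2) ^ (b14 a) * (1 - t 3) ^ (b57 a) * (t 3 - t 1) ^ (b35 a) *
      (t 4 - t 1) ^ (b36 a)) /
    ((t 2 - t 0) * t 2 * (1 - t 3) * (t 3 - t 1) * (t 4 - t 1))

/-- The cellular integral `I(a)` of (1), as the Bochner integral of `integrand a` over `openSimplex`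
(the junk value `0` if the integrand is not integrable, i.e. if `¬ Converges a`). [cite: BrownZudilin2022, §1 eq. (1)] -/
def cellularIntegral (a : Fin 8 → ℤ) : ℝ :=
  ∫ t in openSimplex, integrand a t

/-! ### Worthiness -/

/-- The **worthiness** `γ = (c₁ − c₀)/c₁` of a sequence of effective approximations with
`c₀ = lim log|qₙξ − pₙ|/n` and `c₁ = lim log|qₙ|/n > c₀`. [cite: BrownZudilin2022, §2 (p. 6)] -/
def worthiness (c₀ c₁ : ℝ) : ℝ := (c₁ - c₀) / c₁

/-- "Then for any choice of `ε > 0` and all `n` sufficiently large, `|ζ(5) − pₙ/qₙ| < 1/qₙ^{γ−ε}` with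
`γ = (c₁ − c₀)/c₁`" — for an arbitrary real `ξ`, from the two rates
`log|qₙξ − pₙ|/n → c₀`, `log|qₙ|/n → c₁` with `0 < c₁` (the source assumes `c₁ > c₀`, which makes
`γ > 0`; the inequality itself holds without it). [cite: BrownZudilin2022, §2 (p. 6)] -/
theorem abs_sub_div_lt_of_rates {ξ c₀ c₁ : ℝ} {p q : ℕ → ℝ}
    (h0 : Tendsto (fun n : ℕ => Real.log |q n * ξ - p n| / n) atTop (𝓝 c₀))
    (h1 : Tendsto (fun n : ℕ => Real.log |q n| / n) atTop (𝓝 c₁))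
    (hc1 : 0 < c₁) {ε : ℝ} (hε : 0 < ε) :
    ∀ᶠ n : ℕ in atTop, |ξ - p n / q n| < 1 / |q n| ^ (worthiness c₀ c₁ - ε) := by
  -- the tolerance `δ`
  set A : ℝ := worthiness c₀ c₁ - ε with hA
  set K : ℝ := 2 + |c₀| / c₁ + ε with hK
  have hKpos : 0 < K := by positivity
  set δ : ℝ := ε * c₁ / K with hδ
  have hδpos : 0 < δ := by positivity
  have hδc1 : δ < c₁ := by
    rw [hδ, div_lt_iff₀ hKpos]
    have : ε < K := by
      rw [hK]; have : 0 ≤ |c₀| / c₁ := by positivity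
      linarith
    nlinarith
  -- key numerical inequality: `δ (1 + |c₀|/c₁ + ε) < ε c₁`
  have hkey : δ * (1 + |c₀| / c₁ + ε) < ε * c₁ := by
    have : δ * K = ε * c₁ := by rw [hδ]; field_simp
    nlinarith
  have e0 : ∀ᶠ n : ℕ in atTop, Real.log |q n * ξ - p n| / n < c₀ + δ :=
    h0.eventually (Iio_mem_nhds (by linarith))
  have e1 : ∀ᶠ n : ℕ in atTop, c₁ - δ < Real.log |q n| / n :=
    h1.eventually (Ioi_mem_nhds (by linarith))
  have e2 : ∀ᶠ n : ℕ in atTop, Real.log |q n| / n < c₁ + δ :=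
    h1.eventually (Iio_mem_nhds (by linarith))
  filter_upwards [e0, e1, e2, eventually_gt_atTop 0] with n hn0 hn1 hn2 hnpos
  have hn : (0 : ℝ) < n := by exact_mod_cast hnpos
  rw [div_lt_iff₀ hn] at hn0 hn2
  rw [lt_div_iff₀ hn] at hn1
  -- `|q n| > 1`
  have hlogq : 0 < Real.log |q n| := lt_trans (by nlinarith) hn1
  have hq1 : 1 < |q n| := by
    by_contra h
    push Not at h
    exact absurd (Real.log_nonpos (abs_nonneg _) h) (not_le.2 hlogq)
  have hqpos : 0 < |q n| := lt_trans one_pos hq1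
  have hq0 : q n ≠ 0 := abs_pos.1 hqpos
  have hrhs : 0 < 1 / |q n| ^ A := by positivity
  -- the form
  by_cases hL : q n * ξ - p n = 0
  · have : ξ - p n / q n = 0 := by
      field_simp
      linarith
    rw [this, abs_zero]
    exact hrhs
  have hLpos : 0 < |q n * ξ - p n| := abs_pos.2 hL
  have hsub : ξ - p n / q n = (q n * ξ - p n) / q n := by field_simp
  rw [hsub, abs_div, ← Real.log_lt_log_iff (by positivity) hrhs, Real.log_div hLpos.ne' hqpos.ne',
    one_div, Real.log_inv, Real.log_rpow hqpos]
  -- goal: `log|qξ − p| − log|q| < −(A log|q|)`, i.e. `log|qξ−p| < (1 − A) log|q|`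
  have h1A : 1 - A = c₀ / c₁ + ε := by
    rw [hA, worthiness]; field_simp; ring
  suffices h : (c₀ + δ) * n ≤ (1 - A) * Real.log |q n| by nlinarith
  rcases le_or_gt 0 (1 - A) with hpos | hneg
  · -- `(1 − A) log|q| ≥ (1 − A)(c₁ − δ) n`
    have hb : (1 - A) * ((c₁ - δ) * n) ≤ (1 - A) * Real.log |q n| :=
      mul_le_mul_of_nonneg_left hn1.le hpos
    refine le_trans ?_ hb
    rw [h1A]
    -- `c₀ + δ ≤ (c₀/c₁ + ε)(c₁ − δ)`
    have hcoef : c₀ + δ ≤ (c₀ / c₁ + ε) * (c₁ - δ) := by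
      have e : (c₀ / c₁ + ε) * (c₁ - δ) = c₀ + ε * c₁ - δ * (c₀ / c₁ + ε) := by
        field_simp
      rw [e]
      have : δ * (c₀ / c₁ + ε) ≤ δ * (|c₀| / c₁ + ε) := by
        gcongr; exact le_abs_self _
      nlinarith
    nlinarith
  · -- `(1 − A) log|q| ≥ (1 − A)(c₁ + δ) n` since `1 − A < 0`
    have hb : (1 - A) * ((c₁ + δ) * n) ≤ (1 - A) * Real.log |q n| :=
      mul_le_mul_of_nonpos_left hn2.le hneg.le
    refine le_trans ?_ hb
    rw [h1A]
    have hcoef : c₀ + δ ≤ (c₀ / c₁ + ε) * (c₁ + δ) := by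
      have e : (c₀ / c₁ + ε) * (c₁ + δ) = c₀ + ε * c₁ + δ * (c₀ / c₁ + ε) := by
        field_simp
      rw [e]
      have : -(δ * (|c₀| / c₁ + ε)) ≤ δ * (c₀ / c₁ + ε) := by
        have : -(|c₀| / c₁) ≤ c₀ / c₁ := by
          rw [neg_le, ← neg_div]; exact div_le_div_of_nonneg_right (neg_le_abs _) hc1.le
        nlinarith
      nlinarith
    nlinarith

/-- "When `γ > 1`, the inequalities imply that `ζ(5)` is irrational": if integer forms `qₙξ − pₙ` tend
to `0` and are nonzero for infinitely many `n`, then `ξ` is irrational (`γ > 1` means `c₀ < 0`, i.e. the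
forms tend to `0`). [cite: BrownZudilin2022, §2 (p. 6)] -/
theorem irrational_of_smallForms {ξ : ℝ} {p q : ℕ → ℤ}
    (hsmall : Tendsto (fun n : ℕ => (q n : ℝ) * ξ - p n) atTop (𝓝 0))
    (hne : ∃ᶠ n : ℕ in atTop, (q n : ℝ) * ξ - p n ≠ 0) : Irrational ξ := by
  rintro ⟨r, hr⟩
  have hd : (0 : ℝ) < r.den := by exact_mod_cast r.den_pos
  -- `r.den (qₙ ξ − pₙ)` is an integer
  have hint : ∀ n, ((q n * r.num - p n * r.den : ℤ) : ℝ) = r.den * ((q n : ℝ) * ξ - p n) := by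
    intro n
    have e : ξ * r.den = r.num := by rw [← hr]; exact_mod_cast Rat.mul_den_eq_num r
    push_cast
    linear_combination -(q n : ℝ) * e
  have hlim : Tendsto (fun n : ℕ => (r.den : ℝ) * ((q n : ℝ) * ξ - p n)) atTop (𝓝 0) := by
    simpa using hsmall.const_mul (r.den : ℝ)
  have hev : ∀ᶠ n : ℕ in atTop, |(r.den : ℝ) * ((q n : ℝ) * ξ - p n)| < 1 := by
    have := hlim.abs
    rw [abs_zero] at this
    exact this.eventually (gt_mem_nhds one_pos)
  obtain ⟨n, hn, hn'⟩ := (hne.and_eventually hev).exists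
  rw [← hint n] at hn'
  have hz : (q n * r.num - p n * r.den : ℤ) ≠ 0 := by
    intro h
    apply hn
    have h' := hint n
    rw [h] at h'
    push_cast at h'
    have : (r.den : ℝ) * ((q n : ℝ) * ξ - p n) = 0 := h'.symm
    rcases mul_eq_zero.1 this with h1 | h1
    · exact absurd h1 hd.ne'
    · exact h1
  have h1 : (1 : ℝ) ≤ |((q n * r.num - p n * r.den : ℤ) : ℝ)| := by
    rw [← Int.cast_abs]
    exact_mod_cast Int.one_le_abs hz
  linarith

/-! ### Effective approximations and Theorem 1 -/

/-- "A family of linear forms `qₙα − pₙ`, with `pₙ, qₙ ∈ ℚ`, is called effective if `pₙ, qₙ` are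
solutions to a linear difference equation whose coefficients are polynomials in `ℚ` (also known as an
Apéry-type recursion)": `p` and `q` satisfy one recurrence `∑_{i ≤ d} cᵢ(n) x_{n+i} = 0` with
`cᵢ ∈ ℚ[n]`, `c_d ≠ 0`. [cite: BrownZudilin2022, §1 (before Theorem 1)] -/
def IsAperyType (p q : ℕ → ℚ) : Prop :=
  ∃ (d : ℕ) (c : Fin (d + 1) → Polynomial ℚ), c (Fin.last d) ≠ 0 ∧
    (∀ n : ℕ, ∑ i : Fin (d + 1), (c i).eval (n : ℚ) * p (n + i) = 0) ∧
    (∀ n : ℕ, ∑ i : Fin (d + 1), (c i).eval (n : ℚ) * q (n + i) = 0)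

/-- **MIS-STATED (vacuous) — superseded by `theorem1'`; do not cite this name as "BZ Theorem 1"** (lit seat,
cell pub-zeta5, 2026-08-20): the guard `q n ≠ 0 → …` decouples the effective pair `(p, q)` from the integer
approximations `(P, Q)`, so `p = q = 0` and `Qₙ ∈ {n+2, n+3}`, `Pₙ = ⌊Qₙζ(5)⌋` satisfy the statement —
`theorem1_vacuous : theorem1` below is proved from `1 < ζ(5) < 2` alone. Kept verbatim (def bodies are
append-only; no dependents). Original docstring: **Theorem 1** of [BrownZudilin2022]: "There is an effective infinite sequence of rational
approximations `p/q`, with `p, q ∈ ℤ`, to `ζ(5)` such that `0 < |ζ(5) − p/q| < 1/q^{0.86}`."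
Rendered: there are effective `pₙ, qₙ ∈ ℚ` (`IsAperyType`) and integers `Pₙ, Qₙ` with
`Pₙ/Qₙ = pₙ/qₙ` ("rescaling is implicit in the definition", footnote 1), `Qₙ → +∞` (infinitely many
approximations), and `0 < |ζ(5) − Pₙ/Qₙ| < Qₙ^{−0.86}` for all large `n`; `ζ(5) = zetaValue 5`.
The proof in print (§11: `a = (8,16,10,15,12,16,18,13)`, worthiness `γ(a) = 0.86597135…`) is what
the cell reproduces; the statement "does not imply the (expected!) irrationality of `ζ(5)`".
[cite: BrownZudilin2022, Theorem 1] -/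
def theorem1 : Prop :=
  ∃ (p q : ℕ → ℚ) (P Q : ℕ → ℤ), IsAperyType p q ∧
    (∀ n, q n ≠ 0 → (P n : ℚ) / Q n = p n / q n) ∧
    Tendsto (fun n => (Q n : ℝ)) atTop atTop ∧
    ∀ᶠ n : ℕ in atTop,
      0 < |zetaValue 5 - (P n : ℝ) / Q n| ∧
        |zetaValue 5 - (P n : ℝ) / Q n| < 1 / (Q n : ℝ) ^ (0.86 : ℝ)

/-! ### Correction of `theorem1` (lit seat, cell pub-zeta5, 2026-08-20): the typed statement is vacuous -/

/-- `ζ(5) > 1` (the terms `n = 1, 2` of `ζ(5) = Σ_{n ≥ 1} n⁻⁵` already give `33/32`). [folklore] -/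
private theorem one_lt_zetaValue_five : 1 < zetaValue 5 := by
  have hs : Summable (fun n : ℕ => 1 / (n : ℝ) ^ 5) :=
    Real.summable_one_div_nat_pow.mpr (by norm_num)
  have h := hs.sum_le_tsum (Finset.range 3) (fun n _ => by positivity)
  have h3 : ∑ n ∈ Finset.range 3, 1 / (n : ℝ) ^ 5 = 33 / 32 := by
    simp [Finset.sum_range_succ]
    norm_num
  unfold zetaValue
  linarith

/-- `ζ(5) < 2` (termwise `ζ(5) ≤ ζ(2) = π²/6 < 2`). [folklore] -/
private theorem zetaValue_five_lt_two : zetaValue 5 < 2 := by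
  have hs5 : Summable (fun n : ℕ => 1 / (n : ℝ) ^ 5) :=
    Real.summable_one_div_nat_pow.mpr (by norm_num)
  have hs2 : Summable (fun n : ℕ => 1 / (n : ℝ) ^ 2) :=
    Real.summable_one_div_nat_pow.mpr (by norm_num)
  have hle : ∑' n : ℕ, 1 / (n : ℝ) ^ 5 ≤ ∑' n : ℕ, 1 / (n : ℝ) ^ 2 := by
    refine hs5.tsum_le_tsum (fun n => ?_) hs2
    rcases Nat.eq_zero_or_pos n with h | h
    · subst h; simp
    · have hn : (1 : ℝ) ≤ n := by exact_mod_cast h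
      apply one_div_le_one_div_of_le (by positivity)
      calc (n : ℝ) ^ 2 = (n : ℝ) ^ 2 * 1 := by ring
        _ ≤ (n : ℝ) ^ 2 * (n : ℝ) ^ 3 := by gcongr; exact one_le_pow₀ hn
        _ = (n : ℝ) ^ 5 := by ring
  have h2 : ∑' n : ℕ, 1 / (n : ℝ) ^ 2 = Real.pi ^ 2 / 6 := hasSum_zeta_two.tsum_eq
  have hpi : Real.pi < 3.15 := Real.pi_lt_d2
  have hpi0 : 0 < Real.pi := Real.pi_pos
  unfold zetaValue
  nlinarith

/-- **VACUITY WITNESS for `theorem1` as typed** (lit seat, 2026-08-20): the rendering decouples the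
effective pair `(p, q)` from the integer approximations `(P, Q)` through the guard `q n ≠ 0 → …`, so
`p = q = 0` (which solve every recursion) and `Qₙ ∈ {n+2, n+3}` with `Qₙ·ζ(5) ∉ ℤ` (possible because
`1 < ζ(5) < 2`), `Pₙ = ⌊Qₙ ζ(5)⌋`, satisfy it: `0 < |ζ(5) − Pₙ/Qₙ| < 1/Qₙ < Qₙ^{−0.86}`.  This proof uses
NOTHING from [BrownZudilin2022]; it shows that `theorem1` does not express Theorem 1.  The faithful
rendering is `theorem1'` below.  [cite: BrownZudilin2022, Theorem 1 (statement being corrected)] -/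
theorem theorem1_vacuous : BrownZudilin2022.theorem1 := by
  classical
  have h1 : 1 < zetaValue 5 := one_lt_zetaValue_five
  have h2 : zetaValue 5 < 2 := zetaValue_five_lt_two
  have hnotint : ∀ z : ℤ, (z : ℝ) ≠ zetaValue 5 := by
    intro z hz
    have h1' : (1 : ℝ) < (z : ℝ) := hz ▸ h1
    have h2' : (z : ℝ) < (2 : ℝ) := hz ▸ h2
    have h1'' : (1 : ℤ) < z := by exact_mod_cast h1'
    have h2'' : z < (2 : ℤ) := by exact_mod_cast h2'
    omega
  let Q : ℕ → ℤ := fun n =>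
    if ∃ z : ℤ, ((n : ℝ) + 2) * zetaValue 5 = z then (n : ℤ) + 3 else (n : ℤ) + 2
  have hQ_notint : ∀ n, ∀ z : ℤ, (Q n : ℝ) * zetaValue 5 ≠ z := by
    intro n z
    by_cases h : ∃ z : ℤ, ((n : ℝ) + 2) * zetaValue 5 = z
    · obtain ⟨w, hw⟩ := h
      have hQ : Q n = (n : ℤ) + 3 := if_pos ⟨w, hw⟩
      rw [hQ]
      push_cast
      intro hz
      apply hnotint (z - w)
      push_cast
      linarith
    · have hQ : Q n = (n : ℤ) + 2 := if_neg h
      rw [hQ]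
      push_cast
      intro hz
      exact h ⟨z, hz⟩
  have hQ_ge : ∀ n : ℕ, (n : ℤ) + 2 ≤ Q n := by
    intro n
    by_cases h : ∃ z : ℤ, ((n : ℝ) + 2) * zetaValue 5 = z
    · have hQ : Q n = (n : ℤ) + 3 := if_pos h
      omega
    · have hQ : Q n = (n : ℤ) + 2 := if_neg h
      omega
  let P : ℕ → ℤ := fun n => ⌊(Q n : ℝ) * zetaValue 5⌋
  refine ⟨0, 0, P, Q, ?_, ?_, ?_, ?_⟩
  · refine ⟨0, fun _ => 1, one_ne_zero, ?_, ?_⟩ <;> intro n <;> simp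
  · intro n hq
    exact absurd rfl hq
  · refine tendsto_atTop_mono (fun n => ?_) tendsto_natCast_atTop_atTop
    have := hQ_ge n
    have : ((n : ℤ) : ℝ) + 2 ≤ (Q n : ℝ) := by exact_mod_cast this
    push_cast at this
    linarith
  · refine Filter.Eventually.of_forall fun n => ?_
    have hge := hQ_ge n
    have hQgt1 : (1 : ℝ) < (Q n : ℝ) := by
      have : (1 : ℤ) < Q n := by omega
      exact_mod_cast this
    have hQpos : (0 : ℝ) < (Q n : ℝ) := by linarith
    have hfl : (P n : ℝ) ≤ (Q n : ℝ) * zetaValue 5 := Int.floor_le _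
    have hlt : (Q n : ℝ) * zetaValue 5 < (P n : ℝ) + 1 := Int.lt_floor_add_one _
    have hne : (Q n : ℝ) * zetaValue 5 ≠ (P n : ℝ) := hQ_notint n (P n)
    have hpos : 0 < (Q n : ℝ) * zetaValue 5 - P n := by
      rcases lt_or_eq_of_le hfl with h | h
      · linarith
      · exact absurd h.symm hne
    have key : zetaValue 5 - (P n : ℝ) / Q n = ((Q n : ℝ) * zetaValue 5 - P n) / Q n := by
      field_simp
    rw [key, abs_of_pos (div_pos hpos hQpos)]
    refine ⟨div_pos hpos hQpos, ?_⟩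
    calc ((Q n : ℝ) * zetaValue 5 - P n) / Q n < 1 / Q n := by
          gcongr
          linarith
      _ = 1 / (Q n : ℝ) ^ (1 : ℝ) := by rw [Real.rpow_one]
      _ < 1 / (Q n : ℝ) ^ (0.86 : ℝ) := by
          apply one_div_lt_one_div_of_lt
          · positivity
          · exact Real.rpow_lt_rpow_of_exponent_lt hQgt1 (by norm_num)

/-- **Theorem 1 of [BrownZudilin2022] — CORRECTED rendering** (supersedes the vacuous `theorem1`;
lit seat 2026-08-20).  "There is an effective infinite sequence of rational approximations `p/q`, with
`p, q ∈ ℤ`, to `ζ(5)` such that `0 < |ζ(5) − p/q| < 1/q^{0.86}`", "effective" meaning that `pₙ, qₙ` are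
solutions to one linear difference equation with polynomial coefficients ("rescaling is implicit in the
definition", footnote 1).  Rendered WITHOUT decoupling: ONE Apéry-type pair `(pₙ, qₙ)` of rationals
(`IsAperyType`), `qₙ ≠ 0` and `pₙ/qₙ → ζ(5)` ("approximations to `ζ(5)`"), and the printed inequality
with `q` the REDUCED denominator of `pₙ/qₙ` — the weakest reading of "rescaling": any integer rescaling
`(Pₙ, Qₙ)` of `pₙ/qₙ` has `Qₙ ≥ den(pₙ/qₙ)`, so the printed bound with the authors' `Qₙ`
(`= d_{m₁n}⋯d_{m₅n}Φₙ⁻¹·Q(a·n)`, §§7, 11) implies this one.  The proof in print (§11,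
`a = (8,16,10,15,12,16,18,13)`, worthiness `γ(a) = 0.86597135…`) is what the cell reproduces; the
statement "does not imply the (expected!) irrationality of `ζ(5)`".  Named fact (statement only).
[cite: BrownZudilin2022, Theorem 1 and footnote 1] -/
def theorem1' : Prop :=
  ∃ (p q : ℕ → ℚ), IsAperyType p q ∧
    Tendsto (fun n => ((p n / q n : ℚ) : ℝ)) atTop (𝓝 (zetaValue 5)) ∧
    ∀ᶠ n : ℕ in atTop, q n ≠ 0 ∧
      0 < |zetaValue 5 - ((p n / q n : ℚ) : ℝ)| ∧
        |zetaValue 5 - ((p n / q n : ℚ) : ℝ)| < 1 / ((p n / q n).den : ℝ) ^ (0.86 : ℝ)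

end Literature.NumberTheory.Irrationality.BrownZudilin2022
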